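import Summits.ResolutionOfSingularities.ResolutionOfSingularities.Theorems.WeightedInvariantHypersurfaceLocalGameEFT4SDimLETwo
import Summits.ResolutionOfSingularities.ResolutionOfSingularities.Theorems.WeightedInvariantIotaOrder
import Summits.ResolutionOfSingularities.ResolutionOfSingularities.Theorems.WeightedInvariantIotaOrderUpperSemicontinuous
import HarnessLib

/-!
# The ι-side of the P2 rung is closed by name: `P2Rung p iotaOrd J` from the five `J`-dependent pieces
# (door `HypersurfaceCentreConstruction`, stmt-ResolutionOfSingularities-19897, ORDER (o24) of res-L1-w43-plan-1)

[OURS · L1 W4.3 · cell `res-hironaka`, HUMAN RULING D-0089] Helper file `--supports stmt-ResolutionOfSingularities-19897`,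
after-care of ORDER (o24-S) (`Theorems/WeightedInvariantHypersurfaceLocalGameEFT4SDimLETwo.lean`, p512950). Typer res-type-073
(gen 10). AI-produced, weaker than expert review. NOT a statement of the manuscript under review (Hironaka 2017,
[claim: Hironaka2017, status: under-review]); nothing here is attributed to its author; nothing here is a claim about
resolution of singularities. No definitions, no mathematics: bookkeeping for the (o24) assembly.

`P2Rung p ι J` (p512950) is the conjunction of ten clauses; five of them do not mention `J` and are THEOREMS of the tree for
`ι = iotaOrd`: (c6) `iotaOrd_isoInvariant`, (c7) `iotaOrd_generizationMonotone`, (c10) `iotaOrd_torusFactorMonotone`, (c12a-ι)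
`iotaOrd_unitInvariant` (res-type-073, `…IotaOrder`, p502169) and (c8) `iotaOrd_upperSemicontinuous` (res-type-039,
`…IotaOrderUpperSemicontinuous`, p502844). Hence:

* `p2Rung_iotaOrd_of_pieces` — for ANY `J`: `JIsoInvariant J`, `IotaJEssSmoothCompatibleLE2 iotaOrd J` ((o24-C)),
  `CanonicalGameClauseLE2 p iotaOrd J` ((o24-G)), `JOpenPresentationForallSingLE2 p iotaOrd J` ((o24-O)) and
  `JUnitInvariant J` ((o24-D)) give `P2Rung p iotaOrd J`. With `J := jContact` ((o24-D)) this is the (o24) TARGET OF RECORD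
  `∀ p, p.Prime → P2Rung p iotaOrd jContact` minus exactly the five ordered pieces.
* `p2Rung_iotaOrd_iff` — conversely the five pieces are read back off the rung (so the rung for `iotaOrd` IS the
  conjunction of the five `J`-pieces).
-/

noncomputable section

set_option linter.dupNamespace false -- mandated namespace `Summit.<Summit>.<Problem>` of this single-conjunct summit

open IsLocalRing Literature.AlgebraicGeometry.Resolution

namespace Summit.ResolutionOfSingularities.ResolutionOfSingularities.Cruxes.HypersurfaceCentreConstruction.LocalEngine

/-- **The ι-side of the P2 rung, by name.** For every `J`, the five `J`-dependent pieces — `JIsoInvariant J` ((o24-D)),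
`IotaJEssSmoothCompatibleLE2 iotaOrd J` ((o24-C)), `CanonicalGameClauseLE2 p iotaOrd J` ((o24-G)),
`JOpenPresentationForallSingLE2 p iotaOrd J` ((o24-O)), `JUnitInvariant J` ((o24-D)) — give `P2Rung p iotaOrd J`; the five
`ι`-only conjuncts are the tree theorems `iotaOrd_isoInvariant`, `iotaOrd_generizationMonotone`,
`iotaOrd_upperSemicontinuous`, `iotaOrd_torusFactorMonotone`, `iotaOrd_unitInvariant`. [OURS · L1 W4.3, kernel bookkeeping] -/
theorem p2Rung_iotaOrd_of_pieces (p : ℕ) (J : (R : Type) → [CommRing R] → R → ℕ → Ideal R)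
    (hJiso : JIsoInvariant J) (hc11 : IotaJEssSmoothCompatibleLE2 iotaOrd J)
    (hgame : CanonicalGameClauseLE2 p iotaOrd J) (hopen : JOpenPresentationForallSingLE2 p iotaOrd J)
    (hJunit : JUnitInvariant J) : P2Rung p iotaOrd J :=
  ⟨iotaOrd_isoInvariant, iotaOrd_generizationMonotone, iotaOrd_upperSemicontinuous, iotaOrd_torusFactorMonotone,
    hJiso, hc11, hgame, hopen, iotaOrd_unitInvariant, hJunit⟩

/-- The rung for `iotaOrd` IS the conjunction of the five `J`-pieces. [OURS · L1 W4.3, kernel bookkeeping] -/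
theorem p2Rung_iotaOrd_iff (p : ℕ) (J : (R : Type) → [CommRing R] → R → ℕ → Ideal R) :
    P2Rung p iotaOrd J ↔
      JIsoInvariant J ∧ IotaJEssSmoothCompatibleLE2 iotaOrd J ∧ CanonicalGameClauseLE2 p iotaOrd J ∧
        JOpenPresentationForallSingLE2 p iotaOrd J ∧ JUnitInvariant J :=
  ⟨fun ⟨_, _, _, _, h5, h6, h7, h8, _, h10⟩ => ⟨h5, h6, h7, h8, h10⟩,
    fun ⟨h5, h6, h7, h8, h10⟩ => p2Rung_iotaOrd_of_pieces p J h5 h6 h7 h8 h10⟩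

/-- The (o24) TARGET OF RECORD reduced to the five pieces, uniformly in the prime `p`: if the `J`-pieces hold for every
prime `p` then `∀ p, p.Prime → P2Rung p iotaOrd J`. [OURS · L1 W4.3, kernel bookkeeping] -/
theorem forall_p2Rung_iotaOrd_of_pieces (J : (R : Type) → [CommRing R] → R → ℕ → Ideal R)
    (hJiso : JIsoInvariant J) (hc11 : IotaJEssSmoothCompatibleLE2 iotaOrd J)
    (hgame : ∀ p : ℕ, p.Prime → CanonicalGameClauseLE2 p iotaOrd J)
    (hopen : ∀ p : ℕ, p.Prime → JOpenPresentationForallSingLE2 p iotaOrd J)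
    (hJunit : JUnitInvariant J) : ∀ p : ℕ, p.Prime → P2Rung p iotaOrd J :=
  fun p hp => p2Rung_iotaOrd_of_pieces p J hJiso hc11 (hgame p hp) (hopen p hp) hJunit

end Summit.ResolutionOfSingularities.ResolutionOfSingularities.Cruxes.HypersurfaceCentreConstruction.LocalEngine

end
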